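import Mathlib
import Summits.ABC.ABC.Theorems.SoloInformedOnePrime
import Summits.ABC.ABC.Theorems.SoloInformedFactorialProd
import Summits.ABC.ABC.Theorems.SoloInformedTheoremBParams
import Summits.ABC.ABC.Theorems.SoloInformedTheoremBCounting

/-!
# Solo (informed) — Theorem B from Theorem A, in the kernel (core case)

**Theorem A** (hypothesis `hA`) is Y. Bugeaud – M. Laurent, J. Number Theory **61** (1996)
311–342, Théorème 1, over `ℚ_p` (`D = 1`, `e = f = 1`, `t = u = 0`, `g = p - 1`) for rational
`p`-units, with the single change `γᵢ ↦ 1/2` justified in the report (paper §2.3, Lemma X =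
`soloInformed_lemmaX`; audit `paper/TheoremA-audit.md`): hypothesis (1) is stated through
residues in `ZMod p`, hypothesis (2) with `(L/2)((R-1)h₁ + (S-1)h₂)` in place of
`γ₁LRh(α₁) + γ₂LSh(α₂)`, conclusion `v_p(α₁^{b₁} - α₂^{b₂}) ≤ KL - 1/2`; further weakened to
`p ≥ 5`, `p ∤ b₁`, `b ≥ 1`, heights `≤ hᵢ`.  It is NOT proved here (Baker's method is not in
Mathlib): it is an explicit hypothesis, a modification of a published theorem under adjudication.
This file: the core case `G = g·a₁a₂ ≥ 5/2 ⇒ W(p) ≤ 100G + 4` for the pair `(2u/v, u/v)`.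
-/

namespace Summit.ABC.ABC.Theorems

open Finset

/-- Radii bookkeeping: `R = ⌊√A⌋+1`, `S = ⌊√B⌋+1` with `AB = c²` give `R-1 ≤ √A`, `S-1 ≤ √B`,
`c < RS`. -/
theorem soloInformed_radii {A B c : ℝ} (hA : 0 ≤ A) (hc : 0 ≤ c) (hAB : A * B = c ^ 2)
    {R S : ℕ} (hR : R = ⌊Real.sqrt A⌋₊ + 1) (hS : S = ⌊Real.sqrt B⌋₊ + 1) :
    (R : ℝ) - 1 ≤ Real.sqrt A ∧ (S : ℝ) - 1 ≤ Real.sqrt B ∧ c < (R : ℝ) * S := by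
  have h1 : (R : ℝ) - 1 ≤ Real.sqrt A := by
    rw [hR]; push_cast; linarith [Nat.floor_le (Real.sqrt_nonneg A)]
  have h2 : (S : ℝ) - 1 ≤ Real.sqrt B := by
    rw [hS]; push_cast; linarith [Nat.floor_le (Real.sqrt_nonneg B)]
  refine ⟨h1, h2, ?_⟩
  have h3 : Real.sqrt A < R := by rw [hR]; push_cast; exact Nat.lt_floor_add_one _
  have h4 : Real.sqrt B < S := by rw [hS]; push_cast; exact Nat.lt_floor_add_one _
  have h5 : Real.sqrt A * Real.sqrt B = c := by
    rw [← Real.sqrt_mul hA, hAB, Real.sqrt_sq hc]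
  have := mul_lt_mul'' h3 h4 (Real.sqrt_nonneg _) (Real.sqrt_nonneg _)
  linarith

section TheoremA

/- Theorem A as an explicit hypothesis (see the module docstring). -/
variable (hA : ∀ (p : ℕ) [Fact p.Prime], 5 ≤ p →
  ∀ (α₁ α₂ : ℚ), α₁ ≠ 0 → α₂ ≠ 0 → padicValRat p α₁ = 0 → padicValRat p α₂ = 0 →
  (∀ m n : ℤ, α₁ ^ m * α₂ ^ n = 1 → m = 0 ∧ n = 0) →
  ∀ (h₁ h₂ : ℝ), Real.log (max (α₁.num.natAbs : ℝ) (α₁.den : ℝ)) ≤ h₁ →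
    Real.log (max (α₂.num.natAbs : ℝ) (α₂.den : ℝ)) ≤ h₂ →
  ∀ (K L R₁ R₂ S₁ S₂ b₁ b₂ : ℕ), 3 ≤ K → 2 ≤ L → 1 ≤ R₁ → 1 ≤ R₂ → 1 ≤ S₁ → 1 ≤ S₂ →
    1 ≤ b₁ → 1 ≤ b₂ → ¬ p ∣ b₁ →
  (1 : ℝ) ≤ (((R₁ : ℝ) + R₂ - 2) * b₂ + ((S₁ : ℝ) + S₂ - 2) * b₁) / 2
      * (∏ k ∈ Finset.range K, (k.factorial : ℝ)) ^ (-(2 : ℝ) / ((K : ℝ) ^ 2 - K)) →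
  (∃ κ : ZMod p, L ≤ (((Finset.range R₁ ×ˢ Finset.range S₁).filter
      (fun rs : ℕ × ℕ => (α₁ : ZMod p) ^ rs.1 * (α₂ : ZMod p) ^ rs.2 = κ)).image
      (fun rs : ℕ × ℕ => α₁ ^ rs.1 * α₂ ^ rs.2)).card) →
  (∃ κ : ZMod p, (K - 1) * L < (((Finset.range R₂ ×ˢ Finset.range S₂).filter
      (fun rs : ℕ × ℕ => (α₁ : ZMod p) ^ rs.1 * (α₂ : ZMod p) ^ rs.2 = κ)).image
      (fun rs : ℕ × ℕ => rs.1 * b₂ + rs.2 * b₁)).card) →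
  3 * Real.log ((K : ℝ) * L)
    + ((K : ℝ) - 1) * Real.log ((((R₁ : ℝ) + R₂ - 2) * b₂ + ((S₁ : ℝ) + S₂ - 2) * b₁) / 2
        * (∏ k ∈ Finset.range K, (k.factorial : ℝ)) ^ (-(2 : ℝ) / ((K : ℝ) ^ 2 - K)))
    + (L : ℝ) / 2 * (((R₁ : ℝ) + R₂ - 2) * h₁ + ((S₁ : ℝ) + S₂ - 2) * h₂)
    < (K : ℝ) * (L - 1) * Real.log p →
  (padicValRat p (α₁ ^ b₁ - α₂ ^ b₂) : ℝ) ≤ (K : ℝ) * L - 1 / 2)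

include hA

set_option maxHeartbeats 1600000 in
/-- **Theorem B, core case** (`G = g a₁ a₂ ≥ 5/2`): `W(p) ≤ 100 G + 4`. -/
theorem soloInformed_theoremB_core {p : ℕ} (hp : p.Prime) (hp2 : p ≠ 2) {u v : ℕ}
    (hu : Odd u) (hv : Odd v) (huv : u ≠ v) (hcop : Nat.Coprime u v)
    (hpu : ¬ p ∣ u) (hpv : ¬ p ∣ v) (u₂ uy : (ZMod p)ˣ) (hu₂ : (u₂ : ZMod p) = 2)
    (huy : (uy : ZMod p) * v = u) {g : ℕ}
    (hg : Nat.card (Subgroup.closure ({u₂, uy} : Set (ZMod p)ˣ)) ≤ g)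
    {a₁ a₂ : ℝ} (ha₁ : Real.log ((2 * max u v : ℕ) : ℝ) ≤ a₁ * Real.log p)
    (ha₂ : Real.log ((max u v : ℕ) : ℝ) ≤ a₂ * Real.log p) (hG : 5 / 2 ≤ (g : ℝ) * a₁ * a₂) :
    (padicValNat p (2 ^ (p - 1) - 1) : ℝ) ≤ 100 * ((g : ℝ) * a₁ * a₂) + 4 := by
  classical
  haveI : Fact p.Prime := ⟨hp⟩
  have hu0 : u ≠ 0 := by rintro rfl; exact absurd hu (by decide)
  have hv0 : v ≠ 0 := by rintro rfl; exact absurd hv (by decide)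
  set G : ℝ := (g : ℝ) * a₁ * a₂ with hGdef
  set Lp : ℝ := Real.log p with hLpdef
  set e : ℕ := orderOf (2 : ZMod p) with he_def
  set W : ℕ := padicValNat p (2 ^ (p - 1) - 1) with hW_def
  set H : Subgroup (ZMod p)ˣ := Subgroup.closure ({u₂, uy} : Set (ZMod p)ˣ) with hHdef
  have hp3 : 3 ≤ p := by have := hp.two_le; omega
  have hp3r : (3 : ℝ) ≤ p := by exact_mod_cast hp3
  have hLp1 : 1 < Lp := by
    rw [hLpdef, Real.lt_log_iff_exp_lt (by positivity)]
    exact lt_of_lt_of_le (lt_trans Real.exp_one_lt_d9 (by norm_num)) hp3r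
  have hLp0 : 0 < Lp := by linarith
  have hmax3 : 3 ≤ max u v := by
    obtain ⟨a, rfl⟩ := hu; obtain ⟨b, rfl⟩ := hv; omega
  have hlogmax : 1 ≤ Real.log ((max u v : ℕ) : ℝ) := by
    rw [Real.le_log_iff_exp_le (by positivity)]
    have : (3 : ℝ) ≤ ((max u v : ℕ) : ℝ) := by exact_mod_cast hmax3
    linarith [Real.exp_one_lt_d9]
  have hlog2max : 1 ≤ Real.log ((2 * max u v : ℕ) : ℝ) := by
    refine hlogmax.trans (Real.log_le_log (by positivity) ?_)
    exact_mod_cast Nat.le_mul_of_pos_left _ (by norm_num)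
  have ha₁' : 1 ≤ a₁ * Lp := hlog2max.trans ha₁
  have ha₂' : 1 ≤ a₂ * Lp := hlogmax.trans ha₂
  have ha₁0 : 0 < a₁ := by
    by_contra h; push Not at h; nlinarith
  have ha₂0 : 0 < a₂ := by
    by_contra h; push Not at h; nlinarith
  have hG0 : 0 < G := by linarith
  have h2ne0 : (2 : ZMod p) ≠ 0 := by rw [← hu₂]; exact u₂.ne_zero
  have hu₂H : u₂ ∈ H := Subgroup.subset_closure (by simp)
  have huyH : uy ∈ H := Subgroup.subset_closure (by simp)
  have he_u₂ : orderOf u₂ = e := by rw [he_def, ← hu₂, orderOf_units]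
  have he_pos : 0 < e := by rw [← he_u₂]; exact orderOf_pos u₂
  have hH_pos : 0 < Nat.card H := Nat.card_pos
  have he_dvd_H : e ∣ Nat.card H := by
    have h := orderOf_dvd_natCard (⟨u₂, hu₂H⟩ : H)
    rw [← Subgroup.orderOf_coe] at h
    rw [← he_u₂]; exact h
  have he_le_g : e ≤ g := (Nat.le_of_dvd hH_pos he_dvd_H).trans hg
  have hg_pos : 0 < g := lt_of_lt_of_le he_pos he_le_g
  have he_dvd : e ∣ p - 1 := ZMod.orderOf_dvd_card_sub_one h2ne0
  have he_lt_p : e < p := by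
    have := Nat.le_of_dvd (by have := hp.two_le; omega) he_dvd
    omega
  have hg1 : (1 : ℝ) ≤ g := by exact_mod_cast hg_pos
  have heg : (e : ℝ) ≤ g := by exact_mod_cast he_le_g
  have he0r : (0 : ℝ) < e := by exact_mod_cast he_pos
  -- Liouville: W log p < e log 2, and the generic exit
  have hLiou : (W : ℝ) * Lp < (e : ℝ) * Real.log 2 := soloInformed_wieferichExp_mul_log_lt hp hp2
  have hlog2 := Real.log_two_lt_d9; have hlog2' := Real.log_two_gt_d9
  have hexit : ∀ B : ℝ, (e : ℝ) * Real.log 2 ≤ B * Lp → (W : ℝ) ≤ B := by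
    intro B hB
    exact (lt_of_mul_lt_mul_right (lt_of_lt_of_le hLiou hB) hLp0.le).le
  -- Case 1: small p
  by_cases hsmall : Lp < 100 * Real.log 2
  · apply hexit
    -- e log 2 Lp ≤ 100 e ≤ 100 G Lp²
    have h1 : Real.log 2 * Lp ≤ 100 := by nlinarith
    have h2 : (e : ℝ) ≤ G * Lp * Lp := by
      have : G * Lp * Lp = g * (a₁ * Lp) * (a₂ * Lp) := by rw [hGdef]; ring
      rw [this]
      calc (e : ℝ) ≤ g := heg
        _ = g * 1 * 1 := by ring
        _ ≤ g * (a₁ * Lp) * (a₂ * Lp) := by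
            apply mul_le_mul (mul_le_mul_of_nonneg_left ha₁' (by linarith)) ha₂' (by norm_num)
            positivity
    have h3 : (e : ℝ) * Real.log 2 * Lp ≤ (100 * G + 4) * Lp * Lp := by nlinarith
    exact le_of_mul_le_mul_right h3 hLp0
  push Not at hsmall
  -- parameters
  set K : ℕ := ⌊20 * G⌋₊ + 1 with hKdef
  set R₁ : ℕ := ⌊Real.sqrt (5 * g * a₂ / a₁)⌋₊ + 1 with hR₁def
  set S₁ : ℕ := ⌊Real.sqrt (5 * g * a₁ / a₂)⌋₊ + 1 with hS₁def
  set R₂ : ℕ := ⌊Real.sqrt (5 * g * ((K : ℝ) - 1) * a₂ / a₁)⌋₊ + 1 with hR₂def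
  set S₂ : ℕ := ⌊Real.sqrt (5 * g * ((K : ℝ) - 1) * a₁ / a₂)⌋₊ + 1 with hS₂def
  have hK20 : 20 * G < K := by rw [hKdef]; push_cast; exact Nat.lt_floor_add_one _
  have hKle : (K : ℝ) ≤ 20 * G + 1 := by
    rw [hKdef]; push_cast; linarith [Nat.floor_le (show 0 ≤ 20 * G by positivity)]
  have hK51 : 51 ≤ K := by
    rw [hKdef]
    have : (50 : ℕ) ≤ ⌊20 * G⌋₊ := Nat.le_floor (by push_cast; linarith)
    omega
  have hK1r : (0 : ℝ) < (K : ℝ) - 1 := by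
    have : (51 : ℝ) ≤ K := by exact_mod_cast hK51
    linarith
  have hKm1 : (((K - 1 : ℕ)) : ℝ) = (K : ℝ) - 1 := by
    rw [Nat.cast_sub (by omega)]; simp
  -- floors and products of the radii
  obtain ⟨hR₁le, hS₁le, h5g⟩ := soloInformed_radii (c := 5 * (g : ℝ)) (B := 5 * g * a₁ / a₂)
    (by positivity) (by positivity) (by field_simp) hR₁def hS₁def
  obtain ⟨hR₂le, hS₂le, h5gK⟩ := soloInformed_radii (c := 5 * (g : ℝ) * ((K : ℝ) - 1))
    (B := 5 * g * ((K : ℝ) - 1) * a₁ / a₂)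
    (by positivity) (by positivity) (by field_simp) hR₂def hS₂def
  have hprod₁ : g * 5 < R₁ * S₁ := by
    exact_mod_cast (show ((g * 5 : ℕ) : ℝ) < ((R₁ * S₁ : ℕ) : ℝ) by push_cast; linarith)
  have hprod₂ : g * (5 * (K - 1)) < R₂ * S₂ := by
    exact_mod_cast (show ((g * (5 * (K - 1)) : ℕ) : ℝ) < ((R₂ * S₂ : ℕ) : ℝ) by
      push_cast [Nat.cast_sub (by omega : 1 ≤ K)]; linarith)
  have hRS3 : 3 ≤ R₂ + S₂ := by
    by_contra h
    have hR : R₂ ≤ 1 := by omega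
    have hS : S₂ ≤ 1 := by omega
    have := Nat.mul_le_mul hR hS
    have : 1 ≤ g * (5 * (K - 1)) := Nat.mul_pos hg_pos (by omega)
    omega
  -- Case 2a: e ≤ 2 (K - 1)  (then the bound is trivial)
  by_cases heK : e ≤ 2 * (K - 1)
  · apply hexit
    have h1 : (e : ℝ) ≤ 2 * ((K : ℝ) - 1) := by
      have : ((e : ℕ) : ℝ) ≤ ((2 * (K - 1) : ℕ) : ℝ) := by exact_mod_cast heK
      rw [Nat.cast_mul, hKm1] at this; exact_mod_cast this
    nlinarith
  push Not at heK
  -- Case 2b: R₂ > e and S₂ > e  (then e a₁ ≤ 10 G and the bound is trivial)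
  by_cases hRS : R₂ ≤ e ∨ S₂ ≤ e
  swap
  · push Not at hRS
    apply hexit
    have h1 : (e : ℝ) ≤ Real.sqrt (5 * g * ((K : ℝ) - 1) * a₂ / a₁) := by
      have : (e : ℝ) ≤ (R₂ : ℝ) - 1 := by
        have : e + 1 ≤ R₂ := hRS.1
        have : ((e : ℕ) : ℝ) + 1 ≤ R₂ := by exact_mod_cast this
        linarith
      exact this.trans hR₂le
    have h2 : (e : ℝ) * a₁ ≤ 10 * G := by
      have h3 := mul_le_mul_of_nonneg_left h1 ha₁0.le
      rw [soloInformed_mul_sqrt_div _ _ ha₁0 (by positivity)] at h3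
      have h4 : Real.sqrt (5 * g * ((K : ℝ) - 1) * a₂ * a₁) ≤ 10 * G := by
        rw [Real.sqrt_le_iff]; refine ⟨by positivity, ?_⟩
        have : (K : ℝ) - 1 ≤ 20 * G := by linarith
        calc 5 * (g : ℝ) * ((K : ℝ) - 1) * a₂ * a₁ = 5 * G * ((K : ℝ) - 1) := by rw [hGdef]; ring
          _ ≤ 5 * G * (20 * G) := by apply mul_le_mul_of_nonneg_left this (by positivity)
          _ = (10 * G) ^ 2 := by ring
      linarith
    -- e log 2 ≤ e ≤ e a₁ Lp ≤ 10 G Lp ≤ (100 G + 4) Lp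
    have h5 : (e : ℝ) ≤ (e : ℝ) * (a₁ * Lp) := by nlinarith
    nlinarith
  -- Main case: apply Theorem A to (α₁, α₂) = (2u/v, u/v), L = 5, b₁ = b₂ = e.
  have hp5 : 5 ≤ p := by
    by_contra h
    push Not at h
    have : (p : ℝ) ≤ 4 := by exact_mod_cast Nat.lt_succ_iff.mp h
    have : Lp ≤ Real.log 4 := Real.log_le_log (by positivity) this
    have : Real.log 4 = 2 * Real.log 2 := by
      rw [show (4 : ℝ) = 2 ^ 2 by norm_num, Real.log_pow]; norm_num
    linarith
  set α₁ : ℚ := ((2 * u : ℕ) : ℚ) / v with hα₁def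
  set α₂ : ℚ := (u : ℚ) / v with hα₂def
  have hα₁0 : α₁ ≠ 0 := by positivity
  have hα₂0 : α₂ ≠ 0 := by positivity
  have hp2u : ¬ p ∣ 2 * u := by
    intro h
    rcases (Nat.Prime.dvd_mul hp).mp h with h2 | h2
    · have := (Nat.prime_dvd_prime_iff_eq hp Nat.prime_two).mp h2; exact hp2 this
    · exact hpu h2
  have hvα₁ : padicValRat p α₁ = 0 := by
    rw [hα₁def, padicValRat.div (by positivity) (by exact_mod_cast hv0), padicValRat.of_nat,
      padicValRat.of_nat, padicValNat.eq_zero_of_not_dvd hp2u, padicValNat.eq_zero_of_not_dvd hpv]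
    simp
  have hvα₂ : padicValRat p α₂ = 0 := by
    rw [hα₂def, padicValRat.div (by exact_mod_cast hu0) (by exact_mod_cast hv0),
      padicValRat.of_nat, padicValRat.of_nat, padicValNat.eq_zero_of_not_dvd hpu,
      padicValNat.eq_zero_of_not_dvd hpv]
    simp
  -- numerators and denominators
  have hcop₁ : Nat.Coprime (2 * u) v := Nat.Coprime.mul_left (Nat.coprime_two_left.mpr hv) hcop
  have hnum₂ : α₂.num = u := by
    have := Rat.num_div_eq_of_coprime (a := (u : ℤ)) (b := (v : ℤ)) (by exact_mod_cast Nat.pos_of_ne_zero hv0)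
      (by simpa using hcop)
    simpa [hα₂def] using this
  have hden₂ : α₂.den = v := by
    have := Rat.den_div_eq_of_coprime (a := (u : ℤ)) (b := (v : ℤ)) (by exact_mod_cast Nat.pos_of_ne_zero hv0)
      (by simpa using hcop)
    have h' : ((α₂.den : ℤ)) = v := by simpa [hα₂def] using this
    exact_mod_cast h'
  have hnum₁ : α₁.num = (2 * u : ℕ) := by
    have := Rat.num_div_eq_of_coprime (a := ((2 * u : ℕ) : ℤ)) (b := (v : ℤ))
      (by exact_mod_cast Nat.pos_of_ne_zero hv0) (by simpa [Int.natAbs_mul] using hcop₁)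
    simpa [hα₁def] using this
  have hden₁ : α₁.den = v := by
    have := Rat.den_div_eq_of_coprime (a := ((2 * u : ℕ) : ℤ)) (b := (v : ℤ))
      (by exact_mod_cast Nat.pos_of_ne_zero hv0) (by simpa [Int.natAbs_mul] using hcop₁)
    have h' : ((α₁.den : ℤ)) = v := by simpa [hα₁def] using this
    exact_mod_cast h'
  have hh₁ : Real.log (max (α₁.num.natAbs : ℝ) (α₁.den : ℝ)) ≤ a₁ * Lp := by
    refine le_trans (Real.log_le_log (by positivity) ?_) ha₁
    rw [hnum₁, hden₁, Int.natAbs_natCast]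
    have h1 : ((2 * u : ℕ) : ℝ) ≤ ((2 * max u v : ℕ) : ℝ) := by
      exact_mod_cast Nat.mul_le_mul_left 2 (le_max_left u v)
    have h2 : ((v : ℕ) : ℝ) ≤ ((2 * max u v : ℕ) : ℝ) := by
      exact_mod_cast (le_max_right u v).trans (Nat.le_mul_of_pos_left _ (by norm_num))
    exact max_le h1 h2
  have hh₂ : Real.log (max (α₂.num.natAbs : ℝ) (α₂.den : ℝ)) ≤ a₂ * Lp := by
    refine le_trans (le_of_eq ?_) ha₂
    rw [hnum₂, hden₂, Int.natAbs_natCast, Nat.cast_max]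
  -- residues: (α₂ : ZMod p) = uy, (α₁ : ZMod p) = u₂ * uy
  have hvZ : (v : ZMod p) ≠ 0 := by
    intro h; exact hpv ((ZMod.natCast_eq_zero_iff v p).mp h)
  have hcast₂ : (α₂ : ZMod p) = (uy : ZMod p) := by
    rw [Rat.cast_def, hnum₂, hden₂, div_eq_iff hvZ]; push_cast; exact huy.symm
  have hcast₁ : (α₁ : ZMod p) = ((u₂ * uy : (ZMod p)ˣ) : ZMod p) := by
    rw [Rat.cast_def, hnum₁, hden₁, Units.val_mul, hu₂, div_eq_iff hvZ]; push_cast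
    rw [mul_assoc, huy]
  -- the class function and its fibres
  set f : ℕ × ℕ → (ZMod p)ˣ := fun rs => (u₂ * uy) ^ rs.1 * uy ^ rs.2 with hfdef
  have hfH : ∀ rs, f rs ∈ H := fun rs =>
    H.mul_mem (H.pow_mem (H.mul_mem hu₂H huyH) _) (H.pow_mem huyH _)
  have hfilter : ∀ (w : (ZMod p)ˣ) (D : Finset (ℕ × ℕ)),
      D.filter (fun rs : ℕ × ℕ => (α₁ : ZMod p) ^ rs.1 * (α₂ : ZMod p) ^ rs.2 = (w : ZMod p))
        = D.filter (fun rs => f rs = w) := by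
    intro w D
    apply Finset.filter_congr
    intro rs _
    rw [hcast₁, hcast₂, hfdef]
    simp only
    rw [← Units.val_pow_eq_pow_val, ← Units.val_pow_eq_pow_val, ← Units.val_mul, Units.val_inj]
  -- (1a)
  have h1a : ∃ κ : ZMod p, 5 ≤ (((Finset.range R₁ ×ˢ Finset.range S₁).filter
      (fun rs : ℕ × ℕ => (α₁ : ZMod p) ^ rs.1 * (α₂ : ZMod p) ^ rs.2 = κ)).image
      (fun rs : ℕ × ℕ => α₁ ^ rs.1 * α₂ ^ rs.2)).card := by
    obtain ⟨w, hw⟩ := soloInformed_exists_large_class H f hfH R₁ S₁ 5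
      (lt_of_le_of_lt (Nat.mul_le_mul_right _ hg) hprod₁)
    refine ⟨(w : ZMod p), ?_⟩
    rw [hfilter, Finset.card_image_of_injective _ (soloInformed_pair_pow_injective hu hv huv)]
    exact hw.le
  -- (1b)
  have h1b : ∃ κ : ZMod p, (K - 1) * 5 < (((Finset.range R₂ ×ˢ Finset.range S₂).filter
      (fun rs : ℕ × ℕ => (α₁ : ZMod p) ^ rs.1 * (α₂ : ZMod p) ^ rs.2 = κ)).image
      (fun rs : ℕ × ℕ => rs.1 * e + rs.2 * e)).card := by
    obtain ⟨w, hw⟩ := soloInformed_exists_large_class H f hfH R₂ S₂ (5 * (K - 1))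
      (lt_of_le_of_lt (Nat.mul_le_mul_right _ hg) hprod₂)
    refine ⟨(w : ZMod p), ?_⟩
    have hinj := soloInformed_class_injOn u₂ uy w he_pos (R := R₂) (S := S₂)
      (by rw [he_u₂]; exact hRS)
    rw [hfilter, Finset.card_image_of_injOn hinj]
    rw [mul_comm]; exact hw
  -- (2♭) via the parameter inequality
  set F : ℝ := (∏ k ∈ Finset.range K, (k.factorial : ℝ)) ^ (-(2 : ℝ) / ((K : ℝ) ^ 2 - K)) with hFdef
  have hF0 : 0 < F := by
    have := soloInformed_factorialProd_rpow_ge K (by omega)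
    exact lt_of_lt_of_le (by positivity) this
  have hFle : F ≤ Real.exp (3 / 2) * 1.09 / ((K : ℝ) - 1) := by
    have h1 := soloInformed_factorialProd_rpow_le K (by omega)
    have h2 := soloInformed_log_pred_div_le K hK51
    have h3 : Real.exp (3 / 2 + Real.log ((K : ℝ) - 1) / K) ≤ Real.exp (3 / 2) * 1.09 := by
      rw [Real.exp_add]
      apply mul_le_mul_of_nonneg_left _ (Real.exp_pos _).le
      have h4 : Real.exp (Real.log ((K : ℝ) - 1) / K) ≤ Real.exp (Real.log 50 / 51) :=
        Real.exp_le_exp.mpr h2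
      have h5 : Real.exp (Real.log 50 / 51) ≤ 1.09 := by
        have h6 : Real.log 50 / 51 ≤ Real.log 1.09 := by
          have h7 : Real.log 50 ≤ Real.log (1.09 ^ 51) := Real.log_le_log (by norm_num) (by norm_num)
          rw [Real.log_pow] at h7; push_cast at h7
          rw [div_le_iff₀ (by norm_num)]; linarith
        calc Real.exp (Real.log 50 / 51) ≤ Real.exp (Real.log 1.09) := Real.exp_le_exp.mpr h6
          _ = 1.09 := Real.exp_log (by norm_num)
      exact h4.trans h5
    calc F ≤ Real.exp (3 / 2 + Real.log ((K : ℝ) - 1) / K) / ((K : ℝ) - 1) := h1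
      _ ≤ Real.exp (3 / 2) * 1.09 / ((K : ℝ) - 1) := div_le_div_of_nonneg_right h3 hK1r.le
  have heLp : Real.log (e : ℝ) ≤ Lp :=
    Real.log_le_log he0r (by exact_mod_cast he_lt_p.le)
  have h2b := soloInformed_thmB_params (e := (e : ℝ)) hsmall ha₁0 ha₂0 ha₁' ha₂' hg1 hG he0r heLp
    hKdef hR₁le hS₁le hR₂le hS₂le (by omega) (by omega) (by omega) (by omega) hRS3 hF0 hFle
  -- b ≥ 1
  have hb1 : (1 : ℝ) ≤ (((R₁ : ℝ) + R₂ - 2) * e + ((S₁ : ℝ) + S₂ - 2) * e) / 2 * F := by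
    have hFge := soloInformed_factorialProd_rpow_ge K (by omega)
    have hRS' : (1 : ℝ) ≤ ((R₁ : ℝ) + R₂ - 2) + ((S₁ : ℝ) + S₂ - 2) := by
      have : (3 : ℝ) ≤ (R₂ : ℝ) + S₂ := by exact_mod_cast hRS3
      have h1 : (1 : ℝ) ≤ R₁ := by exact_mod_cast (show 1 ≤ R₁ by omega)
      have h2 : (1 : ℝ) ≤ S₁ := by exact_mod_cast (show 1 ≤ S₁ by omega)
      linarith
    have heK' : 2 * ((K : ℝ) - 1) ≤ e := by
      have : ((2 * (K - 1) : ℕ) : ℝ) < ((e : ℕ) : ℝ) := by exact_mod_cast heK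
      rw [Nat.cast_mul, hKm1] at this; push_cast at this; linarith
    have h3 : (((R₁ : ℝ) + R₂ - 2) * e + ((S₁ : ℝ) + S₂ - 2) * e) / 2 * F
        = (e / 2 * F) * (((R₁ : ℝ) + R₂ - 2) + ((S₁ : ℝ) + S₂ - 2)) := by ring
    rw [h3]
    have h4 : (1 : ℝ) ≤ e / 2 * F := by
      calc (1 : ℝ) = ((K : ℝ) - 1) * (1 / ((K : ℝ) - 1)) := by field_simp
        _ ≤ (e / 2) * F := by
            apply mul_le_mul (by linarith) hFge (by positivity) (by positivity)
    nlinarith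
  -- apply Theorem A
  simp only [hFdef] at hb1 h2b
  simp only [hLpdef] at h2b hh₁ hh₂
  have h2c : 3 * Real.log ((K : ℝ) * (5 : ℕ))
      + ((K : ℝ) - 1) * Real.log ((((R₁ : ℝ) + R₂ - 2) * e + ((S₁ : ℝ) + S₂ - 2) * e) / 2
        * (∏ k ∈ Finset.range K, (k.factorial : ℝ)) ^ (-(2 : ℝ) / ((K : ℝ) ^ 2 - K)))
      + ((5 : ℕ) : ℝ) / 2 * (((R₁ : ℝ) + R₂ - 2) * (a₁ * Real.log p)
        + ((S₁ : ℝ) + S₂ - 2) * (a₂ * Real.log p))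
      < (K : ℝ) * ((5 : ℕ) - 1) * Real.log p := by
    push_cast; linarith [h2b]
  have hmain := hA p hp5 α₁ α₂ hα₁0 hα₂0 hvα₁ hvα₂
    (fun m n hmn => soloInformed_pair_independent hu hv huv m n hmn)
    (a₁ * Real.log p) (a₂ * Real.log p) hh₁ hh₂ K 5 R₁ R₂ S₁ S₂ e e (by omega) (by norm_num)
    (by omega) (by omega) (by omega) (by omega) he_pos he_pos
    (fun h => absurd (Nat.le_of_dvd he_pos h) (by omega))
    hb1 h1a h1b h2c
  -- read off W
  have hval : padicValRat p (α₁ ^ e - α₂ ^ e) = padicValNat p (2 ^ e - 1) :=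
    soloInformed_padicValRat_pair_pow_sub hu0 hv0 hpu hpv he_pos
  have hWe : W = padicValNat p (2 ^ e - 1) := soloInformed_padicValNat_two_pow_order_sub_one hp hp2
  rw [hval] at hmain
  have hW5K : (W : ℝ) ≤ (K : ℝ) * 5 - 1 / 2 := by
    rw [hWe]; exact_mod_cast hmain
  have hWint : W + 1 ≤ K * 5 := by
    by_contra h
    push Not at h
    have : ((K * 5 : ℕ) : ℝ) ≤ W := by exact_mod_cast Nat.lt_succ_iff.mp h
    push_cast at this
    linarith
  have : ((W : ℕ) : ℝ) + 1 ≤ (K : ℝ) * 5 := by exact_mod_cast hWint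
  linarith

end TheoremA

end Summit.ABC.ABC.Theorems
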